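import Summits.PneNP.PneNP.Theorems.KarlinRubinMonotoneSufficesTransportAverage

/-!
# Crux `MonotoneSuffices` (stmt-PneNP-18026), line `slice-transport` — stub `stub_transport`, part 7:
# mixing the deletion count with binomial weights

The deletion count `d` of the transport is drawn with weight `λ(d) = b N (m - d)` (`b` the symmetric
binomial point masses, `m = ⌊N/2⌋ + Δ` the transport slice). This file integrates the per-`d`
averaged slice errors of part 6 against `λ`:

* `sum_b_mul_acc_div_le` — the null part collapses EXACTLY onto the unconditional acceptance
  probability: `∑_d λ(d) acc_{m-d}/C(N,m-d) = #{x : |x| ≤ m, f x}/2^N ≤ #{x : f x}/2^N`;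
* `sum_b_mul_rej_le` — the planted part is the unconditional rejection probability up to the
  `ℓ₁`-distance of the slice profiles: `∑_d λ(d) rej_{m-d} ≤ REJ/(#𝒜 2^{N-κ}) + κ/√(N-κ+1)`;
* `sum_b_Ico_le` — the far deletion counts `d > 2Δ` carry weight `≤ N/(4Δ²)` (Chebyshev);
* `mixture_bound` — the resulting bound on `∑_d λ(d) ∑_σ (sliceErrI + sliceErrII)(f ∘ del σ d)`.
-/

set_option linter.dupNamespace false -- `Summit.PneNP.PneNP.…`: summit = sub-problem name (D-0017 single-conjunct layout)

namespace Summit.PneNP.PneNP.Theorems.MonotoneSuffices.SliceTransport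

open Finset Literature.Computability.Complexity.BinomialTV

variable {α : Type*} [Fintype α] [DecidableEq α] {θ : Type*}

/-! ### Weights -/

/-- The weights `λ(d) = b N (m - d)`, `d ≤ m`, have total mass at most one. [folklore] -/
theorem sum_b_reflect_le_one (N m : ℕ) : ∑ d ∈ range (m + 1), b N (m - d) ≤ 1 := by
  have h := sum_range_reflect (fun j => b N j) (m + 1)
  simp only [Nat.add_sub_cancel] at h
  rw [h]
  exact sum_b_le_one N (m + 1)

/-- The weights restricted to `d ≤ 2Δ` have mass at most one. [folklore] -/
theorem sum_b_reflect_range_le_one (N m Δ : ℕ) (h2Δ : 2 * Δ ≤ m) :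
    ∑ d ∈ range (2 * Δ + 1), b N (m - d) ≤ 1 :=
  (sum_le_sum_of_subset_of_nonneg (range_subset_range.2 (by omega)) fun d _ _ => b_nonneg _ _).trans
    (sum_b_reflect_le_one N m)

/-- **Far deletion counts are light**: for `m = ⌊N/2⌋ + Δ`, `Δ > 0`,
`∑_{2Δ < d ≤ m} b N (m - d) ≤ N/(4Δ²)` (these are the weights of the indices `j < ⌊N/2⌋ - Δ`).
[folklore] -/
theorem sum_b_Ico_le (N : ℕ) {m Δ : ℕ} (hm : m = N / 2 + Δ) (hΔ : 0 < Δ) (h2Δ : 2 * Δ ≤ m) :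
    ∑ d ∈ Ico (2 * Δ + 1) (m + 1), b N (m - d) ≤ (N : ℝ) / 4 / (Δ : ℝ) ^ 2 := by
  -- reindex: `d = 2Δ + 1 + k`, `m - d = (m - 2Δ - 1) - k`, then reflect
  rw [sum_Ico_eq_sum_range]
  have hlen : m + 1 - (2 * Δ + 1) = m - 2 * Δ := by omega
  rw [hlen]
  have href := sum_range_reflect (fun j => b N j) (m - 2 * Δ)
  have hterm : ∀ k ∈ range (m - 2 * Δ), b N (m - (2 * Δ + 1 + k)) = b N (m - 2 * Δ - 1 - k) := by
    intro k hk
    congr 1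
    omega
  rw [sum_congr rfl hterm, href]
  -- these indices satisfy `2 (j + Δ) ≤ N`
  calc ∑ j ∈ range (m - 2 * Δ), b N j
      ≤ ∑ j ∈ (range (N + 1)).filter (fun j => 2 * (j + Δ) ≤ N), b N j := by
        refine sum_le_sum_of_subset_of_nonneg (fun j hj => ?_) fun j _ _ => b_nonneg _ _
        rw [mem_range] at hj
        rw [mem_filter, mem_range]
        have := Nat.div_mul_le_self N 2
        omega
    _ ≤ (N : ℝ) / 4 / (Δ : ℝ) ^ 2 := sum_b_le_of_add_le N hΔ

/-- **The total weight is at least `1/2`** once `2N ≤ (Δ+1)²` (for `m = ⌊N/2⌋ + Δ`). [folklore] -/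
theorem half_le_sum_b_reflect (N : ℕ) {m Δ : ℕ} (hm : m = N / 2 + Δ) (hΔN : 2 * N ≤ (Δ + 1) ^ 2) :
    (1 : ℝ) / 2 ≤ ∑ d ∈ range (m + 1), b N (m - d) := by
  have h := sum_range_reflect (fun j => b N j) (m + 1)
  simp only [Nat.add_sub_cancel] at h
  rw [h]
  rcases le_or_gt N m with hNm | hNm
  · -- all the mass is there
    have h1 : ∑ j ∈ range (m + 1), b N j = 1 := by
      rw [← sum_range_add_sum_Ico _ (show N + 1 ≤ m + 1 by omega), sum_b_eq_one,
        sum_eq_zero (fun j hj => b_eq_zero_of_lt (by have := (mem_Ico.1 hj).1; omega)), add_zero]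
    rw [h1]; norm_num
  · -- the missing mass is the right tail `j ≥ ⌊N/2⌋ + (Δ + 1)`
    have hsplit := sum_range_add_sum_Ico (fun j => b N j) (show m + 1 ≤ N + 1 by omega)
    rw [sum_b_eq_one] at hsplit
    have htail : ∑ j ∈ Ico (m + 1) (N + 1), b N j ≤ (N : ℝ) / ((Δ + 1 : ℕ) : ℝ) ^ 2 := by
      calc ∑ j ∈ Ico (m + 1) (N + 1), b N j
          ≤ ∑ j ∈ (range (N + 1)).filter (fun j => N / 2 + (Δ + 1) ≤ j), b N j := by
            refine sum_le_sum_of_subset_of_nonneg (fun j hj => ?_) fun j _ _ => b_nonneg _ _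
            rw [mem_Ico] at hj
            rw [mem_filter, mem_range]
            omega
        _ ≤ (N : ℝ) / ((Δ + 1 : ℕ) : ℝ) ^ 2 := sum_b_le_of_half_add_le N (Nat.succ_pos Δ)
    have hΔ1 : (0 : ℝ) < ((Δ + 1 : ℕ) : ℝ) ^ 2 := by positivity
    have hbound : (N : ℝ) / ((Δ + 1 : ℕ) : ℝ) ^ 2 ≤ 1 / 2 := by
      rw [div_le_iff₀ hΔ1]
      have : (2 : ℝ) * N ≤ ((Δ + 1 : ℕ) : ℝ) ^ 2 := by exact_mod_cast hΔN
      linarith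
    linarith

/-! ### The null part collapses onto the unconditional acceptance probability -/

/-- `b N j / C(N, j) = 1 / 2^N` on the range of the law. [folklore] -/
theorem b_div_choose {N j : ℕ} (hj : j ≤ N) : b N j / (N.choose j : ℝ) = 1 / 2 ^ N := by
  have hpos : (0 : ℝ) < N.choose j := by exact_mod_cast Nat.choose_pos hj
  unfold b
  field_simp

/-- Summing the acceptance counts of the slices `≤ m` counts at most all accepted vectors. [folklore] -/
theorem sum_card_slice_accept_le (f : (α → Bool) → Bool) (m : ℕ) :
    ∑ j ∈ range (m + 1), (#((univ : Finset (α → Bool)).filter fun y =>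
        #(univ.filter fun a => y a = true) = j ∧ f y = true) : ℝ) ≤
      #((univ : Finset (α → Bool)).filter fun y => f y = true) := by
  classical
  set T := (univ : Finset (α → Bool)).filter fun y => f y = true ∧ #(univ.filter fun a => y a = true) < m + 1
    with hT
  have hfib := card_eq_sum_card_fiberwise (s := T) (t := range (m + 1))
    (f := fun y => #(univ.filter fun a => y a = true)) (fun y hy => mem_range.2 (mem_filter.1 hy).2.2)
  have hterm : ∀ j ∈ range (m + 1), #(T.filter fun y => #(univ.filter fun a => y a = true) = j) =
      #((univ : Finset (α → Bool)).filter fun y => #(univ.filter fun a => y a = true) = j ∧ f y = true) := by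
    intro j hj
    rw [mem_range] at hj
    congr 1
    ext y
    simp only [hT, mem_filter, mem_univ, true_and]
    constructor
    · rintro ⟨⟨hf, -⟩, hj'⟩; exact ⟨hj', hf⟩
    · rintro ⟨hj', hf⟩; exact ⟨⟨hf, by omega⟩, hj'⟩
  rw [sum_congr rfl hterm] at hfib
  have hle : #T ≤ #((univ : Finset (α → Bool)).filter fun y => f y = true) :=
    card_le_card (fun y hy => mem_filter.2 ⟨mem_univ _, (mem_filter.1 hy).2.1⟩)
  rw [hfib] at hle
  exact_mod_cast hle

/-- **Null mixture**: `∑_{d ≤ m} b N (m-d) · acc_{m-d}/C(N, m-d) ≤ #{x : f x}/2^N` (`m ≤ N`). [folklore] -/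
theorem sum_b_mul_acc_div_le (f : (α → Bool) → Bool) {m : ℕ} (hm : m ≤ Fintype.card α) :
    ∑ d ∈ range (m + 1), b (Fintype.card α) (m - d) *
        ((#((univ : Finset (α → Bool)).filter fun y =>
            #(univ.filter fun a => y a = true) = m - d ∧ f y = true) : ℝ) / ((Fintype.card α).choose (m - d) : ℝ)) ≤
      (#((univ : Finset (α → Bool)).filter fun y => f y = true) : ℝ) / 2 ^ Fintype.card α := by
  set N := Fintype.card α with hN
  have hterm : ∀ d ∈ range (m + 1), b N (m - d) *
      ((#((univ : Finset (α → Bool)).filter fun y => #(univ.filter fun a => y a = true) = m - d ∧ f y = true) : ℝ) /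
        (N.choose (m - d) : ℝ)) =
      (#((univ : Finset (α → Bool)).filter fun y => #(univ.filter fun a => y a = true) = m - d ∧ f y = true) : ℝ) *
        (1 / 2 ^ N) := by
    intro d _
    rw [← b_div_choose (show m - d ≤ N by omega)]
    ring
  rw [sum_congr rfl hterm, ← sum_mul]
  have href := sum_range_reflect (fun j => (#((univ : Finset (α → Bool)).filter fun y =>
    #(univ.filter fun a => y a = true) = j ∧ f y = true) : ℝ)) (m + 1)
  simp only [Nat.add_sub_cancel] at href
  rw [href, mul_one_div]
  exact div_le_div_of_nonneg_right (sum_card_slice_accept_le f m) (by positivity)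

/-! ### The planted part: unconditional rejection probability plus the profile distance -/

/-- Summing the rejection counts of the planted slices counts at most all rejected pairs. [folklore] -/
theorem sum_card_pairs_reject_le (f : (α → Bool) → Bool) (𝒜 : Finset θ) (Kf : θ → Finset α) (κ R : ℕ) :
    ∑ t ∈ range R, (#((𝒜 ×ˢ (univ : Finset (α → Bool))).filter fun p =>
        Kf p.1 ⊆ (univ.filter fun a => p.2 a = true) ∧ #(univ.filter fun a => p.2 a = true) = κ + t ∧
        f p.2 = false) : ℝ) ≤
      #((𝒜 ×ˢ (univ : Finset (α → Bool))).filter fun p =>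
        Kf p.1 ⊆ (univ.filter fun a => p.2 a = true) ∧ f p.2 = false) := by
  classical
  set T := ((𝒜 ×ˢ (univ : Finset (α → Bool))).filter fun p =>
    Kf p.1 ⊆ (univ.filter fun a => p.2 a = true) ∧ f p.2 = false ∧
      κ ≤ #(univ.filter fun a => p.2 a = true) ∧ #(univ.filter fun a => p.2 a = true) < κ + R) with hT
  have hfib := card_eq_sum_card_fiberwise (s := T) (t := range R)
    (f := fun p => #(univ.filter fun a => p.2 a = true) - κ) (fun p hp => by
      have := (mem_filter.1 hp).2.2.2
      simp only [mem_coe, mem_range]; omega)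
  have hterm : ∀ t ∈ range R, #(T.filter fun p => #(univ.filter fun a => p.2 a = true) - κ = t) =
      #((𝒜 ×ˢ (univ : Finset (α → Bool))).filter fun p =>
        Kf p.1 ⊆ (univ.filter fun a => p.2 a = true) ∧ #(univ.filter fun a => p.2 a = true) = κ + t ∧
        f p.2 = false) := by
    intro t ht
    rw [mem_range] at ht
    congr 1
    ext p
    simp only [hT, mem_filter]
    constructor
    · rintro ⟨⟨hp, hK, hf, h1, h2⟩, h3⟩; exact ⟨hp, hK, by omega, hf⟩
    · rintro ⟨hp, hK, h3, hf⟩; exact ⟨⟨hp, hK, hf, by omega, by omega⟩, by omega⟩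
  rw [sum_congr rfl hterm] at hfib
  have hle : #T ≤ #((𝒜 ×ˢ (univ : Finset (α → Bool))).filter fun p =>
      Kf p.1 ⊆ (univ.filter fun a => p.2 a = true) ∧ f p.2 = false) :=
    card_le_card (fun p hp => by
      have h := mem_filter.1 hp
      exact mem_filter.2 ⟨h.1, h.2.1, h.2.2.1⟩)
  rw [hfib] at hle
  exact_mod_cast hle

/-- **transport_mixture** (registered helper sub-goal of stmt-PneNP-18026 for `stub_transport`,
part 7): mixing the deletion count with the weights `b N (m - d)` collapses the null slice
acceptance fractions onto the unconditional acceptance probability (`sum_b_mul_acc_div_le`).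
[folklore] -/
theorem transport_mixture :
    ∀ {α : Type*} [Fintype α] [DecidableEq α] (f : (α → Bool) → Bool) (m : ℕ), m ≤ Fintype.card α → ∑ d ∈ Finset.range (m + 1), Literature.Computability.Complexity.BinomialTV.b (Fintype.card α) (m - d) * ((#((Finset.univ : Finset (α → Bool)).filter fun y => #(Finset.univ.filter fun a => y a = true) = m - d ∧ f y = true) : ℝ) / ((Fintype.card α).choose (m - d) : ℝ)) ≤ (#((Finset.univ : Finset (α → Bool)).filter fun y => f y = true) : ℝ) / 2 ^ Fintype.card α :=
  fun f _ hm => sum_b_mul_acc_div_le f hm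

end Summit.PneNP.PneNP.Theorems.MonotoneSuffices.SliceTransport
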